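import Summits.ResolutionOfSingularities.ResolutionOfSingularities.Theorems.PurelyInseparableDim4ResConeTwoSlotRelabel
import Summits.ResolutionOfSingularities.ResolutionOfSingularities.Theorems.PurelyInseparableDim4ResConeTwoSlotTail
import HarnessLib
import HarnessLib.Audit.Tags

/-!
# Purely inseparable four-folds — TWO-SLOT GAME: the two extra relabeling identities of a slot step, ON THE CHAIN
# (cell `res-dim4-pi`, K2(p) lane, slice B brick K24a, part γ″, file 2)

[OURS · counted 0 · cell `res-dim4-pi` · K2(p) lane (holder res-dim4-p-12); seat res-dim4-p-1 g4 over its own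
`slot_step_relabel_one_three` / `slot_step_relabel_f_one_two` (`…ResConeTwoSlotRelabel`), dressed on the chain
exactly as `slot_step_readings_chain` dresses `slot_step_readings` (`…ResConeTwoSlotTail`).]  Nothing here proves
K2(p)/K2(5), `NoIsolatedTrap p p` or resolution of singularities in dimension ≥ 4 / characteristic `p`.  AI kernel
work, weaker than expert review.

* **`slot_step_relabel_chain`** — at a slot step `k ≥ k₀` of a power-cone stretch (chart `j k = κ`, translation
  along the free letter `f`, boundary `e_κ + e_o + e_ν` kept, T-sector `ℓ_k f ≠ 0`, slot letters born before `k`,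
  canonical frames `φ` at `k` and `ψ` at `k + 1`): `R′(κ+3o) = R(κ+3o)` and `R′(f+κ+2o) = R(f+κ+2o)` — the instances
  `hfix'` (slot-`A` step) and `hmuT` (slot-`B` step) of the rotating two-slot game.

[cite: CossartJannsenSaito2020, Thm. 3.14] [cite: HauserPerlega2019PRIMS, §2 (the blowup in the x₁-chart)]
bears_on: LADDER-RESOLUTION:D157-DOOR2 (res-dim4-pi · K2(p) · slice B · K24a-γ″).  Supports
stmt-ResolutionOfSingularities-16155 (helper).
-/

set_option linter.dupNamespace false -- mandated namespace of this single-conjunct summit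

noncomputable section

namespace Summit.ResolutionOfSingularities.ResolutionOfSingularities.Theorems.PIDim4

namespace ResCone

open MvPolynomial Finset FrameChange
open Literature.AlgebraicGeometry.Resolution
open Literature.AlgebraicGeometry.Resolution.CentreBlowup
open Literature.AlgebraicGeometry.Resolution.Hauser2010
open Literature.AlgebraicGeometry.Resolution.HauserPerlega2019

variable {K : Type} [Field K]

section Chain

variable [CharP K 5] [DecidableEq K]

/-- **THE TWO EXTRA RELABELINGS OF A SLOT STEP, ON THE CHAIN** (setting of `slot_step_readings_chain`):
`coeff_{r+(e_κ+3e_o)} (clean (τ_ψ F_{k+1})) = coeff_{r+(e_κ+3e_o)} (clean (τ_φ F_k))` and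
`coeff_{r+(e_f+e_κ+2e_o)} (clean (τ_ψ F_{k+1})) = coeff_{r+(e_f+e_κ+2e_o)} (clean (τ_φ F_k))`.
[OURS] [cite: CossartJannsenSaito2020, Thm. 3.14] -/
theorem slot_step_relabel_chain {c : ℕ → State K} {j : ℕ → Fin 4} {b : ℕ → Fin 4 → K}
    (hc : ∀ k, IsIsolated 5 (c k).F ∧ Step0 5 (c k) (c (k + 1))) (hw : FreeTail.IsWitnessedChain 5 c j b)
    (hr0 : ∀ e ∈ (c 0).F.support, (c 0).r ≤ e) {k₀ : ℕ}
    (hord : ∀ k, k₀ ≤ k → ordZero (c k).F = ((6 : ℕ) : ℕ∞)) {ℓ : ℕ → Fin 4 → K} {a0 : ℕ → K}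
    (hform : ∀ k, k₀ ≤ k → resForm (c k) = C (a0 k) * (∑ i, C (ℓ k i) * X i) ^ 3)
    (hdir : ∀ k, k₀ ≤ k → ℓ k (j k) + dotProduct (ℓ k) (b k) = 0) {k : ℕ} (hk : k₀ ≤ k) {κ o ν f : Fin 4}
    (hκo : κ ≠ o) (hκν : κ ≠ ν) (hκf : κ ≠ f) (hoν : o ≠ ν) (hof : o ≠ f) (hνf : ν ≠ f) {r : Fin 4 →₀ ℕ}
    (hr : r = Finsupp.single κ 1 + Finsupp.single o 1 + Finsupp.single ν 1) (hrk : (c k).r = r)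
    (hjk : j k = κ) (hb : b k = Pi.single f (b k f)) (hℓf : ℓ k f ≠ 0)
    (hclean : deletePthPowers 5 (c k).F = (c k).F) (he3' : Module.finrank K (resVertex (c (k + 1))) = 3)
    {φ : MvPolynomial (Fin 4) K} (hφ : f ∉ φ.vars) (h0φ : constantCoeff φ = 0)
    (hφκ : coeff (Finsupp.single κ 1) φ = -(ℓ k κ / ℓ k f))
    (hφ3 : homogeneousComponent 3 (tsch f φ ((c k).F.divMonomial (c k).r)) = C (a0 k * ℓ k f ^ 3) * X f ^ 3)
    (hφN : ∀ n : Fin 4 →₀ ℕ, n f = 2 → n.degree ≤ 9 → coeff n (tsch f φ ((c k).F.divMonomial (c k).r)) = 0)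
    {ψ : MvPolynomial (Fin 4) K} (hψ : f ∉ ψ.vars) (h0ψ : constantCoeff ψ = 0) {a' : K}
    (hψ3 : homogeneousComponent 3 (tsch f ψ ((c (k + 1)).F.divMonomial (c (k + 1)).r)) = C a' * X f ^ 3)
    (hψN : ∀ n : Fin 4 →₀ ℕ, n f = 2 → n.degree ≤ 9 →
      coeff n (tsch f ψ ((c (k + 1)).F.divMonomial (c (k + 1)).r)) = 0) :
    coeff (r + (Finsupp.single κ 1 + Finsupp.single o 3)) (deletePthPowers 5 (tsch f ψ (c (k + 1)).F)) =
        coeff (r + (Finsupp.single κ 1 + Finsupp.single o 3)) (deletePthPowers 5 (tsch f φ (c k).F)) ∧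
      coeff (r + (Finsupp.single f 1 + Finsupp.single κ 1 + Finsupp.single o 2))
          (deletePthPowers 5 (tsch f ψ (c (k + 1)).F)) =
        coeff (r + (Finsupp.single f 1 + Finsupp.single κ 1 + Finsupp.single o 2))
          (deletePthPowers 5 (tsch f φ (c k).F)) := by
  haveI : Fact (Nat.Prime 5) := ⟨by norm_num⟩
  subst hrk
  have hdivk := IsolatedBand.isolated_chain_forall_le hc hr0
  -- the real child is `c (k+1)`
  have hck : c (k + 1) = CentreBlowup.step 5 Finset.univ κ (Pi.single f (b k f)) (c k) := by
    rw [(hw k).2.2.2.2, hjk, ← hb]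
  -- the frame's linear coefficient is the real translation
  have hβ : b k f = -(ℓ k κ / ℓ k f) := by
    refine translation_eq_neg_div hℓf ?_
    have h := hdir k hk
    rw [hjk, hb] at h
    exact h
  have hφκ' : coeff (Finsupp.single κ 1) φ = b k f := by rw [hφκ, hβ]
  have ha0 : a0 k ≠ 0 := ne_zero_of_resForm_eq_C_mul (hord k hk) (hdivk k) (hform k hk)
  have ha : a0 k * ℓ k f ^ 3 ≠ 0 := mul_ne_zero ha0 (pow_ne_zero _ hℓf)
  -- the child data, moved to the `step` form
  have hdiv' : ∀ e ∈ (CentreBlowup.step 5 Finset.univ κ (Pi.single f (b k f)) (c k)).F.support,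
      (CentreBlowup.step 5 Finset.univ κ (Pi.single f (b k f)) (c k)).r ≤ e := by
    rw [← hck]; exact hdivk (k + 1)
  have ho' : ordZero (CentreBlowup.step 5 Finset.univ κ (Pi.single f (b k f)) (c k)).F = ((6 : ℕ) : ℕ∞) := by
    rw [← hck]; exact hord (k + 1) (by omega)
  have he3'' : Module.finrank K (resVertex (CentreBlowup.step 5 Finset.univ κ (Pi.single f (b k f)) (c k))) = 3 := by
    rw [← hck]; exact he3'
  have hψ3' : homogeneousComponent 3 (tsch f ψ ((CentreBlowup.step 5 Finset.univ κ (Pi.single f (b k f)) (c k)).F.divMonomial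
      (CentreBlowup.step 5 Finset.univ κ (Pi.single f (b k f)) (c k)).r)) = C a' * X f ^ 3 := by
    rw [← hck]; exact hψ3
  have hψN' : ∀ n : Fin 4 →₀ ℕ, n f = 2 → n.degree ≤ 7 + 2 →
      coeff n (tsch f ψ ((CentreBlowup.step 5 Finset.univ κ (Pi.single f (b k f)) (c k)).F.divMonomial
        (CentreBlowup.step 5 Finset.univ κ (Pi.single f (b k f)) (c k)).r)) = 0 := by
    rw [← hck]; exact fun n hnf hn => hψN n hnf (by omega)
  have hφN' : ∀ n : Fin 4 →₀ ℕ, n f = 2 → n.degree ≤ 7 + 2 → coeff n (tsch f φ ((c k).F.divMonomial (c k).r)) = 0 :=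
    fun n hnf hn => hφN n hnf (by omega)
  have h1 := slot_step_relabel_one_three hκo hκν hκf hoν hof hνf (s := c k) hr (hdivk k) (hord k hk) hclean hdiv' ho'
    he3'' hφ h0φ hφκ' ha hφ3 (le_refl 7) hφN' hψ h0ψ hψ3' hψN'
  have h2 := slot_step_relabel_f_one_two hκo hκν hκf hoν hof hνf (s := c k) hr (hdivk k) (hord k hk) hclean hdiv' ho'
    he3'' hφ h0φ hφκ' ha hφ3 (le_refl 7) hφN' hψ h0ψ hψ3' hψN'
  rw [← hck] at h1 h2
  exact ⟨h1, h2⟩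

end Chain

end ResCone

end Summit.ResolutionOfSingularities.ResolutionOfSingularities.Theorems.PIDim4

end
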